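import Summits.KontsevichZagierPeriods.KontsevichZagierPeriods.Theorems.FermatIsogenyBetaLinearSectorStubSectorPathsAux
import Literature.NumberTheory.Transcendental.CurvePeriodsTransportProofs
import Literature.NumberTheory.Transcendental.CurvePeriodsGmLoopsProofs
import Literature.NumberTheory.Transcendental.CurvePeriodsProofs
import Mathlib.Analysis.SpecialFunctions.Complex.Log
import Mathlib.LinearAlgebra.FiniteDimensional.Lemmas
import Mathlib.LinearAlgebra.Dimension.Constructions
import Mathlib.LinearAlgebra.LinearIndependent.Lemmas
import Mathlib.Tactic.Module
import HarnessLib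

/-!
# `BetaLinearSector` (stmt-KontsevichZagierPeriods-3897), line `fermat-sector-transport` — SECTOR
# STUB T2 `stub_transportInvY`: transport of Fermat symbols along `g₃(x,y) = (ε̄x/y, 1/y)`

On the affine Fermat curve `F_N = {x^N + y^N = 1} ⊂ ℂ²` with Rohrlich's forms
`ω_{r,s} = x^{r−1}y^{s−1}(y dx − x dy)` (`r, s ≥ 1`), the birational automorphism
`g₃(x, y) = (ε̄x/y, 1/y)`, `ε̄ = e^{−iπ/N}`, `ε = e^{iπ/N}`, satisfies `g₃^*ω_{r,t} = ε̄^r ω_{r,s}` in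
`Ω¹(F_N)` for `r + s + t = N`.  AS MOVES: for a `C¹` path `δ` on `F_N` avoiding `y = 0` on `[0,1]`,
the period symbols `(F_N, ω_{r,s}, δ)` and `ε^r (F_N, ω_{r,t}, g₃ ∘ δ)` differ by a `ℚ̄`-combination of
the elementary relations (R1), (R2), (R4) of `CurvePeriods.IsElementaryRelation` (Huber–Wüstholz 2022,
§13.1: bilinearity and functoriality of pairs).  Since `g₃` is not polynomial on `ℂ²`, the transport
goes through the auxiliary smooth affine curve `Z‴_N = {x^N + y^N = 1, y w = 1} ⊂ ℂ³`
(`transportInvY_isSmoothAffineCurve`: Jacobian of rank `2`, no isolated point) and the two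
polynomial maps `p = (x, y)`, `q = (ε̄ x w, w) : Z‴_N → F_N`; the lifted path is
`δ‴ = (δ_x, δ_y, 1/δ_y)` (`transportInvY_exists_lift`), `p ∘ δ‴ = δ`, `q ∘ δ‴ = g₃ ∘ δ`, and the
form `p^*ω_{r,s} − ε^r q^*ω_{r,t}` vanishes on the tangent lines of `Z‴_N`
(`transportInvY_pointwise`, the chain rule written out).  Everything is explicit algebra plus the
landed smoothness of `F_N` (`isSmoothAffineCurve_fermat`); no named fact is used.

References: B. Gross, *On the periods of abelian integrals and a formula of Chowla and Selberg*
(1978), §1 (with Rohrlich's appendix: the automorphisms of the Fermat curve and the forms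
`ω_{r,s}`); A. Huber, G. Wüstholz, *Transcendence and Linear Relations of 1-Periods* (2022),
§3.3.1, §13.1 (B).
-/

noncomputable section

open scoped BigOperators unitInterval
open MeasureTheory Set MvPolynomial
open Literature.NumberTheory.Transcendental Literature.NumberTheory.Transcendental.CurvePeriods

namespace Summit.KontsevichZagierPeriods.FermatIsogeny.BetaLinearSector

/-! ## The auxiliary curve `Z‴_N = {x^N + y^N = 1, y w = 1} ⊂ ℂ³` -/

/-- `z ∈ Z‴_N ↔ z₀^N + z₁^N = 1 ∧ z₁ z₂ = 1`. [folklore] -/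
theorem transportInvY_mem_points_iff (N : ℕ) (z : Fin 3 → ℂ) :
    z ∈ (⟨3, 2, ![X 0 ^ N + X 1 ^ N - 1, X 1 * X 2 - 1]⟩ : CurveData).points ↔
      z 0 ^ N + z 1 ^ N = 1 ∧ z 1 * z 2 = 1 := by
  refine (CurveData.mem_points (Z := ⟨3, 2, ![X 0 ^ N + X 1 ^ N - 1, X 1 * X 2 - 1]⟩)
    (z := z)).trans ?_
  simp [Fin.forall_fin_two, sub_eq_zero]

/-- The gradient of the first equation `x^N + y^N − 1` of `Z‴_N` at `z` is
`(N z₀^{N−1}, N z₁^{N−1}, 0)`. [folklore] -/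
theorem transportInvY_gradient_zero (N : ℕ) (z : Fin 3 → ℂ) :
    (⟨3, 2, ![X 0 ^ N + X 1 ^ N - 1, X 1 * X 2 - 1]⟩ : CurveData).gradient 0 z =
      ![(N : ℂ) * z 0 ^ (N - 1), (N : ℂ) * z 1 ^ (N - 1), 0] := by
  funext i
  simp only [CurveData.gradient, Matrix.cons_val_zero]
  fin_cases i
  · simp [Derivation.leibniz_pow, pderiv_X_of_ne (show (1 : Fin 3) ≠ 0 by decide)]
  · simp [Derivation.leibniz_pow, pderiv_X_of_ne (show (0 : Fin 3) ≠ 1 by decide)]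
  · simp [Derivation.leibniz_pow, pderiv_X_of_ne (show (0 : Fin 3) ≠ 2 by decide),
      pderiv_X_of_ne (show (1 : Fin 3) ≠ 2 by decide)]

/-- The gradient of the second equation `y w − 1` of `Z‴_N` at `z` is `(0, z₂, z₁)`. [folklore] -/
theorem transportInvY_gradient_one (N : ℕ) (z : Fin 3 → ℂ) :
    (⟨3, 2, ![X 0 ^ N + X 1 ^ N - 1, X 1 * X 2 - 1]⟩ : CurveData).gradient 1 z =
      ![0, z 2, z 1] := by
  funext i
  simp only [CurveData.gradient, Matrix.cons_val_one]
  fin_cases i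
  · simp [pderiv_X_of_ne (show (1 : Fin 3) ≠ 0 by decide),
      pderiv_X_of_ne (show (2 : Fin 3) ≠ 0 by decide)]
  · simp [pderiv_X_of_ne (show (2 : Fin 3) ≠ 1 by decide)]
  · simp [pderiv_X_of_ne (show (1 : Fin 3) ≠ 2 by decide)]

/-- The tangent space of `Z‴_N` at `z`: `N z₀^{N−1} v₀ + N z₁^{N−1} v₁ = 0` and
`z₂ v₁ + z₁ v₂ = 0`. [folklore] -/
theorem transportInvY_mem_tangentSpace_iff (N : ℕ) (z v : Fin 3 → ℂ) :
    v ∈ (⟨3, 2, ![X 0 ^ N + X 1 ^ N - 1, X 1 * X 2 - 1]⟩ : CurveData).tangentSpace z ↔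
      (N : ℂ) * z 0 ^ (N - 1) * v 0 + (N : ℂ) * z 1 ^ (N - 1) * v 1 = 0 ∧
        z 2 * v 1 + z 1 * v 2 = 0 := by
  simp only [CurveData.tangentSpace, mem_setOf_eq, Fin.forall_fin_two, Fin.sum_univ_three]
  rw [show (0 : Fin (⟨3, 2, ![X 0 ^ N + X 1 ^ N - 1, X 1 * X 2 - 1]⟩ : CurveData).m) =
      (0 : Fin 2) from rfl,
    show (1 : Fin (⟨3, 2, ![X 0 ^ N + X 1 ^ N - 1, X 1 * X 2 - 1]⟩ : CurveData).m) =
      (1 : Fin 2) from rfl, transportInvY_gradient_zero, transportInvY_gradient_one]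
  simp

/-- **`Z‴_N = {x^N + y^N = 1, y w = 1} ⊂ 𝔸³` is a smooth affine curve over `ℚ̄`** (`N ≥ 1`): the
equations are over `ℚ`; at a point (`y ≠ 0`) the gradients `(N x^{N−1}, N y^{N−1}, 0)` and
`(0, w, y)` are linearly independent (last entries `0 ≠ y`, then `N y^{N−1} ≠ 0`), so the Jacobian
has rank `2 = 3 − 1`; and `(x, y, 1/y)` is the limit of the lifts `(x′, y′, 1/y′)` of the points
`(x′, y′) ≠ (x, y)` of `F_N` near `(x, y)` (`F_N` has no isolated point, `isSmoothAffineCurve_fermat`).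
[cite: HuberWustholz2022, §3.3.1] -/
theorem transportInvY_isSmoothAffineCurve {N : ℕ} (hN : 1 ≤ N) :
    (⟨3, 2, ![X 0 ^ N + X 1 ^ N - 1, X 1 * X 2 - 1]⟩ : CurveData).IsSmoothAffineCurve where
  algebraic j := by
    fin_cases j
    · simpa using (((hasAlgCoeffs_X (n := 3) 0).pow N).add ((hasAlgCoeffs_X 1).pow N)).sub
        hasAlgCoeffs_one
    · simpa using ((hasAlgCoeffs_X (n := 3) 1).mul (hasAlgCoeffs_X 2)).sub hasAlgCoeffs_one
  rank_eq z hz := by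
    rw [transportInvY_mem_points_iff] at hz
    have hy : z 1 ≠ 0 := left_ne_zero_of_mul_eq_one hz.2
    have hN0 : (N : ℂ) ≠ 0 := Nat.cast_ne_zero.2 (by omega)
    have hfam : (fun j => (⟨3, 2, ![X 0 ^ N + X 1 ^ N - 1, X 1 * X 2 - 1]⟩ : CurveData).gradient j z) =
        ![![(N : ℂ) * z 0 ^ (N - 1), (N : ℂ) * z 1 ^ (N - 1), 0], ![0, z 2, z 1]] := by
      funext j
      fin_cases j
      · simpa using transportInvY_gradient_zero N z
      · simpa using transportInvY_gradient_one N z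
    have hli : LinearIndependent ℂ
        (![![(N : ℂ) * z 0 ^ (N - 1), (N : ℂ) * z 1 ^ (N - 1), 0], ![0, z 2, z 1]] :
          Fin 2 → (Fin 3 → ℂ)) := by
      refine LinearIndependent.pair_iff.2 fun a b hab => ?_
      have h1 := congrFun hab 1
      have h2 := congrFun hab 2
      simp only [Pi.add_apply, Pi.smul_apply, Pi.zero_apply, smul_eq_mul, Matrix.cons_val_one,
        Matrix.cons_val_two, Matrix.head_cons, Matrix.tail_cons, mul_zero, zero_add] at h1 h2
      have hb : b = 0 := (mul_eq_zero.1 h2).resolve_right hy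
      rw [hb, zero_mul, add_zero] at h1
      exact ⟨(mul_eq_zero.1 h1).resolve_right (mul_ne_zero hN0 (pow_ne_zero _ hy)), hb⟩
    rw [hfam, finrank_span_eq_card hli]
    rfl
  not_isolated z hz := by
    rw [transportInvY_mem_points_iff] at hz
    have hy : z 1 ≠ 0 := left_ne_zero_of_mul_eq_one hz.2
    have hw : z 2 = (z 1)⁻¹ := eq_inv_of_mul_eq_one_right hz.2
    -- the point `(z₀, z₁)` of `F_N` is not isolated in `F_N`
    have h2 : (![z 0, z 1] : Fin 2 → ℂ) ∈ (⟨2, 1, ![X 0 ^ N + X 1 ^ N - 1]⟩ : CurveData).points := by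
      rw [mem_points_fermat_iff]
      simpa using hz.1
    have hcl := (isSmoothAffineCurve_fermat hN).not_isolated _ h2
    -- restrict to the open set `{y ≠ 0}`
    have hU : IsOpen {a : Fin 2 → ℂ | a 1 ≠ 0} := isOpen_ne_fun (continuous_apply 1) continuous_const
    have hcl' : (![z 0, z 1] : Fin 2 → ℂ) ∈ closure ({a : Fin 2 → ℂ | a 1 ≠ 0} ∩
        ((⟨2, 1, ![X 0 ^ N + X 1 ^ N - 1]⟩ : CurveData).points \ {![z 0, z 1]})) :=
      hU.inter_closure ⟨by simpa using hy, hcl⟩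
    -- the lift `(x′, y′) ↦ (x′, y′, 1/y′)` is continuous at `(z₀, z₁)` and maps into `Z‴_N ∖ {z}`
    have hφ : ContinuousWithinAt (fun a : Fin 2 → ℂ => (![a 0, a 1, (a 1)⁻¹] : Fin 3 → ℂ))
        ({a : Fin 2 → ℂ | a 1 ≠ 0} ∩
          ((⟨2, 1, ![X 0 ^ N + X 1 ^ N - 1]⟩ : CurveData).points \ {![z 0, z 1]})) ![z 0, z 1] := by
      refine ContinuousAt.continuousWithinAt (continuousAt_pi.2 fun i => ?_)
      fin_cases i
      · simpa using (continuous_apply 0).continuousAt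
      · simpa using (continuous_apply 1).continuousAt
      · simpa using ((continuous_apply 1).continuousAt).fun_inv₀ (by simpa using hy)
    have hmaps : MapsTo (fun a : Fin 2 → ℂ => (![a 0, a 1, (a 1)⁻¹] : Fin 3 → ℂ))
        ({a : Fin 2 → ℂ | a 1 ≠ 0} ∩
          ((⟨2, 1, ![X 0 ^ N + X 1 ^ N - 1]⟩ : CurveData).points \ {![z 0, z 1]}))
        ((⟨3, 2, ![X 0 ^ N + X 1 ^ N - 1, X 1 * X 2 - 1]⟩ : CurveData).points \ {z}) := by
      rintro a ⟨ha1, haF, haz⟩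
      rw [mem_points_fermat_iff] at haF
      rw [mem_setOf_eq] at ha1
      refine ⟨(transportInvY_mem_points_iff N _).2 ⟨by simpa using haF, ?_⟩, fun h => haz ?_⟩
      · simp [ha1]
      · rw [mem_singleton_iff] at h ⊢
        funext i
        fin_cases i
        · simpa using congrFun h 0
        · simpa using congrFun h 1
    have key := hφ.mem_closure hcl' hmaps
    have hz' : (![z 0, z 1, (z 1)⁻¹] : Fin 3 → ℂ) = z := by
      funext i
      fin_cases i <;> simp [hw]
    simp only [Matrix.cons_val_zero, Matrix.cons_val_one] at key
    rwa [hz'] at key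

/-! ## The lifted path `δ‴ = (δ_x, δ_y, 1/δ_y)` on `Z‴_N` -/

/-- THE LIFTED PATH: a `C¹` path `δ` on `F_N` avoiding `y = 0` on `[0,1]` lifts to the `C¹` path
`δ‴ = (δ_x, δ_y, 1/δ_y)` on `Z‴_N`, with algebraic end points (`(1/y)` of an algebraic `y` is
algebraic). [folklore] -/
theorem transportInvY_exists_lift {N : ℕ}
    (δ : CurvePath (⟨2, 1, ![X 0 ^ N + X 1 ^ N - 1]⟩ : CurveData))
    (hδ : ∀ t ∈ Set.Icc (0:ℝ) 1, δ.toFun t 1 ≠ 0) :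
    ∃ δ₃ : CurvePath (⟨3, 2, ![X 0 ^ N + X 1 ^ N - 1, X 1 * X 2 - 1]⟩ : CurveData),
      ∀ t, δ₃.toFun t = ![δ.toFun t 0, δ.toFun t 1, (δ.toFun t 1)⁻¹] := by
  refine ⟨{ toFun := fun t => ![δ.toFun t 0, δ.toFun t 1, (δ.toFun t 1)⁻¹]
            contDiffOn := ?_
            mem_points := ?_
            algebraic_zero := ?_
            algebraic_one := ?_ }, fun t => rfl⟩
  · refine contDiffOn_pi.2 fun i => ?_
    fin_cases i
    · simpa using δ.contDiffOn_apply 0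
    · simpa using δ.contDiffOn_apply 1
    · simpa using (δ.contDiffOn_apply 1).fun_inv hδ
  · intro t ht
    have h := (mem_points_fermat_iff N _).1 (δ.mem_points t ht)
    rw [transportInvY_mem_points_iff]
    exact ⟨by simpa using h, by simpa using mul_inv_cancel₀ (hδ t ht)⟩
  · intro i
    fin_cases i
    · simpa using δ.algebraic_zero 0
    · simpa using δ.algebraic_zero 1
    · simpa using (δ.algebraic_zero 1).inv
  · intro i
    fin_cases i
    · simpa using δ.algebraic_one 0
    · simpa using δ.algebraic_one 1
    · simpa using (δ.algebraic_one 1).inv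

/-! ## The form identity behind (R2) -/

/-- THE VANISHING IDENTITY (pure algebra). At a point `(x, y, w)` of `Z‴_N` (`x^N + y^N = 1`,
`y w = 1`, `N = r + s + t + 3`) and a tangent vector `v` (`x^{N−1} v₀ + y^{N−1} v₁ = 0`), the form
`p^*ω_{r+1,s+1} − ε^{r+1} q^*ω_{r+1,t+1}` (written out through the chain rule, `ε ε̄ = 1`) kills `v`:
multiply by `y^{r+t+2} ≠ 0` and use `(yw)^{r+t+2} = 1`, `(ε ε̄)^{r+1} = 1`. [cite: Gross1978, §1] -/
theorem transportInvY_pointwise (r s t : ℕ) (e a x y w v₀ v₁ v₂ : ℂ) (hea : e * a = 1)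
    (hz₁ : x ^ (r + s + t + 3) + y ^ (r + s + t + 3) = 1) (hz₂ : y * w = 1)
    (hv : x ^ (r + s + t + 2) * v₀ + y ^ (r + s + t + 2) * v₁ = 0) :
    (x ^ r * y ^ (s + 1) - e ^ (r + 1) * ((a * x * w) ^ r * w ^ (t + 1) * (a * w))) * v₀ -
        x ^ (r + 1) * y ^ s * v₁ -
        e ^ (r + 1) * ((a * x * w) ^ r * w ^ (t + 1) * (a * x) - (a * x * w) ^ (r + 1) * w ^ t) *
          v₂ = 0 := by
  have hy : y ≠ 0 := left_ne_zero_of_mul_eq_one hz₂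
  have hyw : (y * w) ^ (r + t + 2) = 1 := by rw [hz₂, one_pow]
  have hεa : e ^ (r + 1) * a ^ (r + 1) = 1 := by rw [← mul_pow, hea, one_pow]
  rw [← mul_right_inj' (pow_ne_zero (r + t + 2) hy), mul_zero]
  linear_combination (x ^ r * v₀) * hz₁ - x ^ (r + 1) * hv - (x ^ r * v₀) * hyw -
    ((y * w) ^ (r + t + 2) * x ^ r * v₀) * hεa

/-! ## The transport `T2` -/

/-- SECTOR STUB T2 (transport along `g₃(x,y) = (ε̄x/y, 1/y)`, "invert `y`"). For positive `r, s, t`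
with `r + s + t = N` and any `C¹` path `δ` on `F_N` avoiding `y = 0` on `[0,1]`, with `δ′ = g₃ ∘ δ`
there: `(F_N, ω_{r,s}, δ) − ε^r (F_N, ω_{r,t}, δ′)` lies in the `ℚ̄`-span of the elementary
relations. Proof: on the auxiliary smooth affine curve `Z‴ = {x^N + y^N = 1, yw = 1} ⊂ ℂ³`
(`transportInvY_isSmoothAffineCurve`) with the polynomial maps `p = (x, y)`, `q = (ε̄xw, w)` to `F_N`
(`q(Z‴) ⊆ F_N` as `ε̄^N = −1`) and the lifted path `δ‴ = (δ_x, δ_y, 1/δ_y)` (`p ∘ δ‴ = δ`,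
`q ∘ δ‴ = δ′`), (R4) gives `(Z‴, p^*ω_{r,s}, δ‴) ∼ (F_N, ω_{r,s}, δ)` and
`(Z‴, q^*ω_{r,t}, δ‴) ∼ (F_N, ω_{r,t}, δ′)`; by the chain rule
`ε^r q^*ω_{r,t} = x^{r−1} w^{r+t} dx`, so `p^*ω_{r,s} − ε^r q^*ω_{r,t}` pairs with a tangent vector `v`
at `(x,y,w) ∈ Z‴` to `x^{r−1}(y^s − w^{r+t}) v₀ − x^r y^{s−1} v₁ = −x^r y^{s−N}(x^{N−1}v₀ + y^{N−1}v₁) = 0`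
(`transportInvY_pointwise`), i.e. it vanishes on `Z‴` (R2); (R1) assembles.
[cite: HuberWustholz2022, §13.1 (B) (p. 120)] [cite: Gross1978, §1] -/
theorem stub_transportInvY : ∀ (N r s t : ℕ), 1 ≤ r → 1 ≤ s → 1 ≤ t → r + s + t = N →
    ∀ (hZ : (⟨2, 1, ![X 0 ^ N + X 1 ^ N - 1]⟩ : CurveData).IsSmoothAffineCurve)
      (hω : ∀ i, HasAlgCoeffs ((![X 0 ^ (r - 1) * X 1 ^ s, -(X 0 ^ r * X 1 ^ (s - 1))] :
        Fin 2 → MvPolynomial (Fin 2) ℂ) i))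
      (hω' : ∀ i, HasAlgCoeffs ((![X 0 ^ (r - 1) * X 1 ^ t, -(X 0 ^ r * X 1 ^ (t - 1))] :
        Fin 2 → MvPolynomial (Fin 2) ℂ) i))
      (δ δ' : CurvePath (⟨2, 1, ![X 0 ^ N + X 1 ^ N - 1]⟩ : CurveData)),
    (∀ t ∈ Set.Icc (0:ℝ) 1, δ.toFun t 1 ≠ 0) →
    (∀ t ∈ Set.Icc (0:ℝ) 1, δ'.toFun t =
      ![Complex.exp (-(↑Real.pi * Complex.I / (N : ℂ))) * δ.toFun t 0 / δ.toFun t 1, (δ.toFun t 1)⁻¹]) →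
    ∃ (k : ℕ) (ρ : Fin k → (PeriodSymbol →₀ ℂ)) (a : Fin k → ℂ),
      (∀ l, IsElementaryRelation (ρ l)) ∧ (∀ l, IsAlgebraic ℚ (a l)) ∧
      (Finsupp.single (⟨(⟨2, 1, ![X 0 ^ N + X 1 ^ N - 1]⟩ : CurveData), hZ,
            (![X 0 ^ (r - 1) * X 1 ^ s, -(X 0 ^ r * X 1 ^ (s - 1))] : Fin 2 → MvPolynomial (Fin 2) ℂ), hω, δ⟩ :
            PeriodSymbol) (1 : ℂ) -
          (Complex.exp (↑Real.pi * Complex.I / (N : ℂ))) ^ r •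
            Finsupp.single (⟨(⟨2, 1, ![X 0 ^ N + X 1 ^ N - 1]⟩ : CurveData), hZ,
              (![X 0 ^ (r - 1) * X 1 ^ t, -(X 0 ^ r * X 1 ^ (t - 1))] :
                Fin 2 → MvPolynomial (Fin 2) ℂ), hω', δ'⟩ : PeriodSymbol) (1 : ℂ)) =
        ∑ l, a l • ρ l := by
  intro N r s t hr hs ht hN hZ hω hω' δ δ' hδ hδ'
  -- positive exponents: `r = r' + 1`, `s = s' + 1`, `t = t' + 1`
  obtain ⟨r, rfl⟩ : ∃ r', r = r' + 1 := ⟨r - 1, by omega⟩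
  obtain ⟨s, rfl⟩ : ∃ s', s = s' + 1 := ⟨s - 1, by omega⟩
  obtain ⟨t, rfl⟩ : ∃ t', t = t' + 1 := ⟨t - 1, by omega⟩
  have hN0 : N ≠ 0 := by omega
  have hN1 : 1 ≤ N := by omega
  -- the constants `ε`, `ε̄`
  set e : ℂ := Complex.exp (↑Real.pi * Complex.I / (N : ℂ)) with he_def
  set a : ℂ := Complex.exp (-(↑Real.pi * Complex.I / (N : ℂ))) with ha_def
  have hea : e * a = 1 := sectorChart_eps_mul_epsBar N
  have haN : a ^ N = -1 := sectorChart_epsBar_pow hN0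
  have he_alg : IsAlgebraic ℚ e := sectorPaths_algebraic_eps hN0
  have ha_alg : IsAlgebraic ℚ a := sectorPaths_algebraic_epsBar hN0
  have her_alg : IsAlgebraic ℚ (e ^ (r + 1)) := he_alg.pow _
  -- the auxiliary curve `Z‴`, its smoothness, the lifted path `δ‴`
  have hZ₃ := transportInvY_isSmoothAffineCurve hN1
  obtain ⟨δ₃, hδ₃⟩ := transportInvY_exists_lift δ hδ
  -- `N = r' + s' + t' + 3`
  obtain rfl : N = r + s + t + 3 := by omega
  -- the forms of the statement
  set ω : Fin 2 → MvPolynomial (Fin 2) ℂ :=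
    ![X 0 ^ (r + 1 - 1) * X 1 ^ (s + 1), -(X 0 ^ (r + 1) * X 1 ^ (s + 1 - 1))] with hω_def
  set ω' : Fin 2 → MvPolynomial (Fin 2) ℂ :=
    ![X 0 ^ (r + 1 - 1) * X 1 ^ (t + 1), -(X 0 ^ (r + 1) * X 1 ^ (t + 1 - 1))] with hω'_def
  -- the maps `p = (x, y)` and `q = (ε̄ x w, w)` from `Z‴` to `F_N`
  obtain ⟨p, hp⟩ : ∃ p : Fin 2 → MvPolynomial (Fin 3) ℂ, p = ![X 0, X 1] := ⟨_, rfl⟩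
  obtain ⟨q, hq⟩ : ∃ q : Fin 2 → MvPolynomial (Fin 3) ℂ, q = ![C a * X 0 * X 2, X 2] := ⟨_, rfl⟩
  have hpalg : ∀ j, HasAlgCoeffs (p j) := by
    intro j
    rw [hp]
    fin_cases j
    · simpa using hasAlgCoeffs_X (n := 3) 0
    · simpa using hasAlgCoeffs_X (n := 3) 1
  have hqalg : ∀ j, HasAlgCoeffs (q j) := by
    intro j
    rw [hq]
    fin_cases j
    · simpa using ((hasAlgCoeffs_C ha_alg).mul (hasAlgCoeffs_X (n := 3) 0)).mul (hasAlgCoeffs_X 2)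
    · simpa using hasAlgCoeffs_X (n := 3) 2
  have hpZ : ∀ z ∈ (⟨3, 2, ![X 0 ^ (r + s + t + 3) + X 1 ^ (r + s + t + 3) - 1, X 1 * X 2 - 1]⟩ :
      CurveData).points, (fun j => eval z (p j)) ∈
        (⟨2, 1, ![X 0 ^ (r + s + t + 3) + X 1 ^ (r + s + t + 3) - 1]⟩ : CurveData).points := by
    intro z hz
    rw [transportInvY_mem_points_iff] at hz
    rw [mem_points_fermat_iff, hp]
    simpa using hz.1
  have hqZ : ∀ z ∈ (⟨3, 2, ![X 0 ^ (r + s + t + 3) + X 1 ^ (r + s + t + 3) - 1, X 1 * X 2 - 1]⟩ :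
      CurveData).points, (fun j => eval z (q j)) ∈
        (⟨2, 1, ![X 0 ^ (r + s + t + 3) + X 1 ^ (r + s + t + 3) - 1]⟩ : CurveData).points := by
    intro z hz
    rw [transportInvY_mem_points_iff] at hz
    rw [mem_points_fermat_iff, hq]
    simp only [Matrix.cons_val_zero, Matrix.cons_val_one, map_mul, eval_C, eval_X]
    have hyw : (z 1 * z 2) ^ (r + s + t + 3) = 1 := by rw [hz.2, one_pow]
    linear_combination (z 0 ^ (r + s + t + 3) * z 2 ^ (r + s + t + 3)) * haN -
      z 2 ^ (r + s + t + 3) * hz.1 + hyw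
  -- the pulled-back forms and the vanishing form `V = p^*ω − ε^{r+1} q^*ω′`
  have hPω : ∀ i, HasAlgCoeffs (formPullback p ω i) := HasAlgCoeffs.formPullback hpalg hω
  have hQω : ∀ i, HasAlgCoeffs (formPullback q ω' i) := HasAlgCoeffs.formPullback hqalg hω'
  have hSω : ∀ i, HasAlgCoeffs ((e ^ (r + 1) • formPullback q ω') i) := fun i =>
    (hQω i).smul her_alg
  have hVω : ∀ i, HasAlgCoeffs ((formPullback p ω - e ^ (r + 1) • formPullback q ω') i) :=
    fun i => (hPω i).sub (hSω i)
  have hV : VanishesOn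
      (⟨3, 2, ![X 0 ^ (r + s + t + 3) + X 1 ^ (r + s + t + 3) - 1, X 1 * X 2 - 1]⟩ : CurveData)
      (formPullback p ω - e ^ (r + 1) • formPullback q ω') := by
    intro z hz v hv
    rw [transportInvY_mem_points_iff] at hz
    rw [transportInvY_mem_tangentSpace_iff] at hv
    obtain ⟨hz₁, hz₂⟩ := hz
    obtain ⟨hv₁, -⟩ := hv
    have hNc : ((r + s + t + 3 : ℕ) : ℂ) ≠ 0 := Nat.cast_ne_zero.2 (by omega)
    have hv₁' : z 0 ^ (r + s + t + 2) * v 0 + z 1 ^ (r + s + t + 2) * v 1 = 0 := by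
      have h3 : ((r + s + t + 3 : ℕ) : ℂ) *
          (z 0 ^ (r + s + t + 2) * v 0 + z 1 ^ (r + s + t + 2) * v 1) = 0 := by
        rw [show r + s + t + 3 - 1 = r + s + t + 2 from rfl] at hv₁
        linear_combination hv₁
      exact (mul_eq_zero.1 h3).resolve_left hNc
    show ∑ i : Fin 3, eval z ((formPullback p ω - e ^ (r + 1) • formPullback q ω') i) * v i = 0
    simp only [Fin.sum_univ_three, hp, hq, hω_def, hω'_def, formPullback, Fin.sum_univ_two,
      Pi.sub_apply, Pi.smul_apply, map_sub, smul_eval, map_add, map_mul, map_neg, map_pow,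
      eval_bind₁_eq, eval_X, eval_C, map_zero, map_one, Matrix.cons_val_zero, Matrix.cons_val_one,
      pderiv_mul, pderiv_C, pderiv_X_self,
      pderiv_X_of_ne (show (0 : Fin 3) ≠ 1 by decide), pderiv_X_of_ne (show (0 : Fin 3) ≠ 2 by decide),
      pderiv_X_of_ne (show (1 : Fin 3) ≠ 0 by decide), pderiv_X_of_ne (show (1 : Fin 3) ≠ 2 by decide),
      pderiv_X_of_ne (show (2 : Fin 3) ≠ 0 by decide), pderiv_X_of_ne (show (2 : Fin 3) ≠ 1 by decide),
      Nat.add_sub_cancel, mul_one, mul_zero, zero_mul, add_zero, zero_add, sub_zero]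
    linear_combination
      transportInvY_pointwise r s t e a (z 0) (z 1) (z 2) (v 0) (v 1) (v 2) hea hz₁ hz₂ hv₁'
  -- the five elementary relations
  have key₁ := IsElementaryRelation.pushforward _ _ hZ₃ hZ p hpalg hpZ ω hω (formPullback p ω)
    hPω rfl δ₃ δ (fun u _ => by
      rw [hδ₃ u, hp]
      funext j
      fin_cases j <;> simp)
  have key₂ := IsElementaryRelation.pushforward _ _ hZ₃ hZ q hqalg hqZ ω' hω' (formPullback q ω')
    hQω rfl δ₃ δ' (fun u hu => by
      rw [hδ' u hu, hδ₃ u, hq]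
      funext j
      fin_cases j
      · simp [div_eq_mul_inv]
      · simp)
  have key₃ := IsElementaryRelation.smul _ hZ₃ δ₃ (e ^ (r + 1)) her_alg (formPullback q ω') _
    hQω hSω rfl
  have key₄ := IsElementaryRelation.add _ hZ₃ δ₃ (formPullback p ω)
    (e ^ (r + 1) • formPullback q ω') (formPullback p ω - e ^ (r + 1) • formPullback q ω')
    hPω hSω hVω (add_sub_cancel _ _).symm
  have key₅ := IsElementaryRelation.vanish _ hZ₃ δ₃ _ hVω hV
  -- assemble
  obtain ⟨k, ρ, c, hρ, hc, hsum⟩ := span_add (span_add (span_add (span_sub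
    (span_smul her_alg (span_of_rel key₂)) (span_of_rel key₁)) (span_of_rel key₃))
    (span_of_rel key₄)) (span_of_rel key₅)
  exact ⟨k, ρ, c, hρ, hc, by rw [← hsum]; module⟩

end Summit.KontsevichZagierPeriods.FermatIsogeny.BetaLinearSector

end
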